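import Literature.NumberTheory.GaloisRepresentations.ArtinConductorWildProofs
import Literature.NumberTheory.GaloisRepresentations.ArtinConductorHerbrandProofs
import Literature.NumberTheory.GaloisRepresentations.ArtinRepresentationProofs
import Literature.NumberTheory.GaloisRepresentations.ArtinRepresentationDifferentProofs
import Literature.RepresentationTheory.FiniteGroups.MonomialCharacters
import HarnessLib

/-!
# The Artin conductor exponent: the specifications from the Hasse–Arf input of Artin's proof
(trunk GalRep, item C10; assembly of the discharges)

Theorems only.  `ArtinConductor.lean` specifies the conductor exponent `a_v(ρ)` of a Galois
representation by named facts (D-0014); the provefact item `natCast_artinConductorExponent`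
(Katz, *Gauss sums, Kloosterman sums, and monodromy groups*, Prop. 1.9) is mis-stated as vendored
(arbitrary topology on the module, hence arbitrary abstract representations — see the faithfulness
notes of `ArtinConductor.lean` and `ArtinConductorWildProofs.lean`), and its faithful forms are
`natCast_artinConductorExponent_of_hasOpenInertiaKerAt` (inertia acts through a finite quotient,
Katz 1.9 as printed), `natCast_artinConductorExponent_lAdic` (Katz 1.9 with Remark 1.10, the
`λ`-adic case used for Tate modules) and the Hausdorff form
`natCast_artinConductorExponent_of_t2Space[_algClosure]` (the provefact statement with `[T2Space M]`
added).  By now the tree proves every printed ingredient of Katz's proof except one of the two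
arithmetic inputs of Serre's proof of Artin's theorem (Ch. VI §2, p. 103):

* Herbrand's theorem `(G/H)^v = G^v H/H` — `herbrand_quotient_holds`,
  `absUpperRamificationSubgroup_map_absRestrictNormalHom_holds` (`ArtinConductorHerbrandProofs`);
* Brauer's induction theorem — `RepTheory.brauer_induction_holds` (`MonomialCharacters`);
* the integrality of the different exponent `hD : card_inf_inertia_dvd_finsum_lowerIndex` (Serre
  IV §1 Cor. to Prop. 4) — `card_inf_inertia_dvd_finsum_lowerIndex_holds`
  (`ArtinRepresentationDifferentProofs`);
* Artin's theorem `f(χ) ∈ ℕ` from Brauer + the two arithmetic inputs (+ the finite-field case in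
  characteristic `ℓ`) — `exists_natCast_eq_artinExponent_of[_charZero]` (`ArtinRepresentationProofs`);
* `G_0/G_1` cyclic, Katz 1.8 (finite wild image of `λ`-adic representations), the cyclic-extension
  transfer and the independence of the prime — `ArtinConductorWildProofs`, `ArtinConductorProofs`,
  `CyclicExtensionIntegrality`.

This file composes them: **each specification holds as soon as the remaining arithmetic input
holds** — `hHA : card_inf_inertia_dvd_finsum_card_inf_ramificationSubgroup` (integrality of `f` on
characters of degree one, VI §2 Cor. to Prop. 5, i.e. Herbrand + Hasse–Arf; a named fact of
`ArtinRepresentation.lean`, below which lies `hasseArf`), quantified over the finite normal layers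
of `K̄/K` — plus, for coefficient fields of positive characteristic only, Artin's theorem over
finite fields (`hfin : exists_natCast_eq_artinExponent_finiteField`, Katz 1.9 with `A = 𝔽_λ`):

* `Literature.GaloisRep.natCast_artinConductorExponent_lAdic_of_arith (hHA)` and
  `Literature.GaloisRep.exists_natCast_eq_artinConductorAt_lAdic_of_arith (hHA)` — the `λ`-adic
  specification and Katz 1.9–1.10 (characteristic `0`: no finite-field input);
* `Literature.GaloisRep.natCast_artinConductorExponent_of_t2Space_of_arith_charZero (hHA)` — the
  Hausdorff form over coefficient fields of characteristic `0`;
* `Literature.GaloisRep.natCast_artinConductorExponent_of_t2Space_of_arith (hHA) (hfin)` and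
  `Literature.GaloisRep.natCast_artinConductorExponent_of_hasOpenInertiaKerAt_of_arith (hHA) (hfin)` —
  all characteristics `≠ p`.

## References

* N. M. Katz, *Gauss Sums, Kloosterman Sums, and Monodromy Groups*, Princeton 1988, Ch. 1,
  1.8, Prop. 1.9 and Remark 1.10. [Katz1988]
* J.-P. Serre, *Local Fields*, GTM 67 (1979), Ch. IV §1 Cor. to Prop. 4, §2 Cor. 1 of Prop. 7,
  §3 Prop. 14; Ch. VI §2 Prop. 5 and Cor., Thm 1' (proof, p. 103), §3. [SerreLocalFields1979]
* J.-P. Serre, *Linear Representations of Finite Groups*, GTM 42 (1977), §10.5 Thm 20, §19.3.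
  [SerreLinearRepresentations1977]
-/

noncomputable section

namespace Literature.NumberTheory.GaloisRepresentations

namespace GaloisRep

open scoped NumberField
open Field IsDedekindDomain

universe u v w

variable {K : Type u} [Field K]

/-- **The `λ`-adic integrality (Katz 1.9 with Remark 1.10) from the Hasse–Arf input.**  For a
number field `K`: the named fact `exists_natCast_eq_artinConductorAt_lAdic` of
`ArtinConductorIntegrality.lean` — `a_𝔓(ρ) ∈ ℕ` for every continuous representation on a
finite-dimensional vector space over a finite extension of `ℚ_ℓ` with its module topology and every
`𝔓 ∣ v ∤ ℓ` — holds as soon as the degree-one integrality `hHA` (VI §2 Cor. to Prop. 5: Herbrand +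
Hasse–Arf) holds for the finite normal layers of `K̄/K` (the different-exponent integrality, IV §1
Cor. to Prop. 4, being `card_inf_inertia_dvd_finsum_lowerIndex_holds`).  Composition of
`exists_natCast_eq_artinConductorAt_lAdic_of_artinExponent_charZero` (Herbrand discharged by
`absUpperRamificationSubgroup_map_absRestrictNormalHom_holds`) with Artin's theorem in
characteristic `0` from Brauer's theorem (`exists_natCast_eq_artinExponent_of_charZero`,
`RepTheory.brauer_induction_holds`).
Ref: Katz (1988), Ch. 1, Prop. 1.9 and Remark 1.10; Serre, *Local Fields*, Ch. VI §2, Thm 1'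
(proof, p. 103). [cite: Katz1988, Ch. 1, Prop. 1.9 and Remark 1.10]
[cite: SerreLocalFields1979, Ch. VI §2, Thm 1' (proof)] -/
theorem exists_natCast_eq_artinConductorAt_lAdic_of_arith
    (hHA : ∀ (R : Type u) [CommRing R] [Algebra R K] (E : IntermediateField K (AlgebraicClosure K)),
      card_inf_inertia_dvd_finsum_card_inf_ramificationSubgroup R (K := K) (L := E)) :
    exists_natCast_eq_artinConductorAt_lAdic.{u, v, w} (K := K) :=
  exists_natCast_eq_artinConductorAt_lAdic_of_artinExponent_charZero
    absUpperRamificationSubgroup_map_absRestrictNormalHom_holds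
    (fun {_} _ _ {_} _ _ =>
      exists_natCast_eq_artinExponent_of_charZero Literature.RepresentationTheory.FiniteGroups.brauer_induction_holds
      (fun R _ _ E => card_inf_inertia_dvd_finsum_lowerIndex_holds R (K := K) (L := E)) hHA)

/-- **The `ℓ`-adic specification of the conductor exponent from the Hasse–Arf input**
(`natCast_artinConductorExponent_lAdic` of `ArtinConductor.lean`, the form used for Tate modules:
`(a_v(ρ) : ℝ) = a_𝔓(ρ)` for every `𝔓 ∣ v ∤ ℓ`).
Ref: Katz (1988), Ch. 1, Prop. 1.9 and Remark 1.10; Serre, *Local Fields*, Ch. VI §2–§3.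
[cite: Katz1988, Ch. 1, Prop. 1.9 and Remark 1.10] -/
theorem natCast_artinConductorExponent_lAdic_of_arith
    (hHA : ∀ (R : Type u) [CommRing R] [Algebra R K] (E : IntermediateField K (AlgebraicClosure K)),
      card_inf_inertia_dvd_finsum_card_inf_ramificationSubgroup R (K := K) (L := E))
    [NumberField K] : natCast_artinConductorExponent_lAdic.{u, v, w} (K := K) :=
  natCast_artinConductorExponent_lAdic_of_lAdic (exists_natCast_eq_artinConductorAt_lAdic_of_arith hHA)

/-- **The Hausdorff form of the provefact statement over coefficient fields of characteristic `0`,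
from the Hasse–Arf input.**  For a number field `K`, `𝔓 ∣ v`, a finite-dimensional continuous
`ρ : Γ_K → GL(M)` over a field `A` of characteristic `0` (any topology on `A`) on a Hausdorff
`A`-module `M` with finite wild image at `𝔓`: `(a_v(ρ) : ℝ) = a_𝔓(ρ)`, provided `hHA` holds.
(`natCast_artinConductorExponent_of_t2Space_algClosure` with Herbrand discharged and Artin's
theorem over `Ā`, of characteristic `0`, from Brauer's theorem.)
Ref: Katz (1988), Ch. 1, Prop. 1.9 and Remark 1.10; Serre, *Local Fields*, Ch. VI §2 Thm 1'.
[cite: Katz1988, Ch. 1, Prop. 1.9 (proof) and Remark 1.10] -/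
theorem natCast_artinConductorExponent_of_t2Space_of_arith_charZero
    (hHA : ∀ (R : Type u) [CommRing R] [Algebra R K] (E : IntermediateField K (AlgebraicClosure K)),
      card_inf_inertia_dvd_finsum_card_inf_ramificationSubgroup R (K := K) (L := E))
    [NumberField K] {A : Type v} [Field A] [CharZero A] [TopologicalSpace A] {M : Type w}
    [AddCommGroup M] [Module A M] [TopologicalSpace M] [T2Space M] [FiniteDimensional A M]
    {v : HeightOneSpectrum (𝓞 K)} {𝔓 : Ideal (absIntegers (𝓞 K) K)} (h𝔓 : 𝔓 ∈ v.primesAbove)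
    (ρ : GaloisRep K A M) (hchar : (v.residueCard : A) ≠ 0) (hρ : ρ.HasFiniteWildImageAt (𝓞 K) 𝔓) :
    (ρ.artinConductorExponent v : ℝ) = ρ.artinConductorAt (𝓞 K) 𝔓 :=
  haveI : CharZero (AlgebraicClosure A) :=
    charZero_of_injective_algebraMap (algebraMap A (AlgebraicClosure A)).injective
  natCast_artinConductorExponent_of_t2Space_algClosure
    absUpperRamificationSubgroup_map_absRestrictNormalHom_holds
    (fun {_} _ _ => exists_natCast_eq_artinExponent_of_charZero Literature.RepresentationTheory.FiniteGroups.brauer_induction_holds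
      (fun R _ _ E => card_inf_inertia_dvd_finsum_lowerIndex_holds R (K := K) (L := E)) hHA)
    h𝔓 ρ hchar hρ

/-- **The Hausdorff form of the provefact statement, all characteristics `≠ p`, from the
Hasse–Arf input and the finite-field case of Artin's theorem.**  As
`natCast_artinConductorExponent_of_t2Space_of_arith_charZero` for an arbitrary coefficient field `A`
with `(q_v : A) ≠ 0`; in characteristic `ℓ > 0` Artin's theorem over `Ā` is reduced in
`ArtinRepresentationProofs` to the case of finite coefficient fields (`hfin`, Katz 1.9 with
`A = 𝔽_λ`, Serre *Linear Representations* §19.3).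
Ref: Katz (1988), Ch. 1, Prop. 1.9; Serre, *Local Fields*, Ch. VI §2 Thm 1'; *Linear
Representations* §19.3. [cite: Katz1988, Ch. 1, Prop. 1.9 (proof) and Remark 1.10] -/
theorem natCast_artinConductorExponent_of_t2Space_of_arith
    (hHA : ∀ (R : Type u) [CommRing R] [Algebra R K] (E : IntermediateField K (AlgebraicClosure K)),
      card_inf_inertia_dvd_finsum_card_inf_ramificationSubgroup R (K := K) (L := E))
    (hfin : ∀ {A' : Type v} [Field A'] {M' : Type v} [AddCommGroup M'] [Module A' M'],
      exists_natCast_eq_artinExponent_finiteField (K := K) (A := A') (M := M'))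
    [NumberField K] {A : Type v} [Field A] [TopologicalSpace A] {M : Type w}
    [AddCommGroup M] [Module A M] [TopologicalSpace M] [T2Space M] [FiniteDimensional A M]
    {v : HeightOneSpectrum (𝓞 K)} {𝔓 : Ideal (absIntegers (𝓞 K) K)} (h𝔓 : 𝔓 ∈ v.primesAbove)
    (ρ : GaloisRep K A M) (hchar : (v.residueCard : A) ≠ 0) (hρ : ρ.HasFiniteWildImageAt (𝓞 K) 𝔓) :
    (ρ.artinConductorExponent v : ℝ) = ρ.artinConductorAt (𝓞 K) 𝔓 :=
  natCast_artinConductorExponent_of_t2Space_algClosure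
    absUpperRamificationSubgroup_map_absRestrictNormalHom_holds
    (fun {_} _ _ => exists_natCast_eq_artinExponent_of Literature.RepresentationTheory.FiniteGroups.brauer_induction_holds
      (fun R _ _ E => card_inf_inertia_dvd_finsum_lowerIndex_holds R (K := K) (L := E)) hHA hfin)
    h𝔓 ρ hchar hρ

/-- **The corrected specification `natCast_artinConductorExponent_of_hasOpenInertiaKerAt` (Katz 1.9
as printed: the inertia group acts through a finite quotient) from the Hasse–Arf input and the
finite-field case**, via `natCast_artinConductorExponent_of_hasOpenInertiaKerAt_of_herbrand`
(`ArtinConductorProofs`) with Herbrand discharged and Artin's theorem from Brauer's theorem.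
Ref: Katz (1988), Ch. 1, Prop. 1.9 and its proof; Serre, *Local Fields*, Ch. VI §2 Thm 1'
(proof, p. 103). [cite: Katz1988, Ch. 1, Prop. 1.9 (and its proof)] -/
theorem natCast_artinConductorExponent_of_hasOpenInertiaKerAt_of_arith
    (hHA : ∀ (R : Type u) [CommRing R] [Algebra R K] (E : IntermediateField K (AlgebraicClosure K)),
      card_inf_inertia_dvd_finsum_card_inf_ramificationSubgroup R (K := K) (L := E))
    (hfin : ∀ {A' : Type v} [Field A'] {M' : Type v} [AddCommGroup M'] [Module A' M'],
      exists_natCast_eq_artinExponent_finiteField (K := K) (A := A') (M := M'))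
    [NumberField K] : natCast_artinConductorExponent_of_hasOpenInertiaKerAt.{u, v, w} (K := K) :=
  natCast_artinConductorExponent_of_hasOpenInertiaKerAt_of_herbrand
    absUpperRamificationSubgroup_map_absRestrictNormalHom_holds
    (fun {_} _ _ {_} _ _ _ => exists_natCast_eq_artinExponent_of Literature.RepresentationTheory.FiniteGroups.brauer_induction_holds
      (fun R _ _ E => card_inf_inertia_dvd_finsum_lowerIndex_holds R (K := K) (L := E)) hHA hfin)

end GaloisRep

end Literature.NumberTheory.GaloisRepresentations

end
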